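import Literature.Computability.QuantumComplexity.PauliPathIntegral
import Literature.InformationTheory.Entropy.VonNeumannEntropy
import Mathlib.Analysis.Matrix.Order
import HarnessLib

/-!
# Direct fidelity estimation of a pure state from importance-sampled Pauli measurements (Flammia–Liu 2011)

S. T. Flammia, Y.-K. Liu, *Direct fidelity estimation from few Pauli measurements*, Phys. Rev.
Lett. **106**, 230501 (2011), arXiv:1104.4695 [FlammiaLiu2011], "Fidelity Estimation" paragraph
(eqs. (1)–(6), (9)), "Well-conditioned states", and Appendix A ("Bounding the Failure Probabilities"),
in the tree's qubit-register Pauli vocabulary (`Pauli`, `pauliString`, `pauliCoeff`, the Pauli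
expansion / resolution of the identity `PauliPath.trace_mul_eq_inv_mul_sum` of
`Literature/Computability/QuantumComplexity/Pauli*.lean`).

pub-qadeq lane, CLAIMS row **E-46** (Martiel et al., IBM + UChicago, arXiv:2607.25941, 'Sampling
hard circuits with verifiably high fidelity'): the certificate input `F₁` of that row is obtained by
direct fidelity estimation — main text p2: "a random Clifford circuit, whose output state fidelity can
be measured and verified efficiently using direct fidelity estimation (DFE) [20, 21]. Notably, DFE
makes no assumptions about hardware noise"; SI §S3.1 eq. (S41): "Since ρ is pure,
Σ_{P∈Pⁿ} χ_ρ(P)² = 1. The DFE relevance distribution is therefore p(P) = χ_ρ(P)², supported on Paulis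
with χ_ρ(P) ≠ 0, and the fidelity can be written as F(ρ, σ) = E_{P∼p}[χ_σ(P)/χ_ρ(P)]", (S42) "In the
absence of experimental or calibration bias, E[F̂] = F(ρ, σ)"; §S3.3: "Since |Tr(P σ)| ≤ 1, this
random variable is bounded by B_ρ … Hoeffding's inequality gives L = O(B_ρ² log(1/δ)/ε²)"
[MartielEtAl2026]. Its ref. [20] is [FlammiaLiu2011]. This file fixes, for an `n`-qubit register
`ι → Bool` with `d = 2^{|ι|}`:

* `sqrtDim ι = √d`; the **characteristic function** `charFn ρ S = Tr(ρ W_S)/√d` (FL: "Define the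
  characteristic function χ_ρ(k) = Tr(ρ W_k/√d)"; we take the real part of `Tr(W_S ρ)`, which IS
  `Tr(ρ W_S)` for Hermitian `ρ`: `star_pauliCoeff_of_isHermitian`, `ofReal_charFn`);
* **eq. (2)** `trace_mul_eq_sum_charFn`: `Tr(ρσ) = Σ_S χ_ρ(S) χ_σ(S)` for Hermitian `ρ, σ` — a
  corollary of the tree's resolution of the identity in the Pauli basis;
* the **relevance distribution** `prob ρ S = χ_ρ(S)²` (eq. (3) "Pr(k) = (χ_ρ(k))²") with
  `sum_prob_eq` (`Σ_S χ_ρ(S)² = Tr(ρ²)`) and `sum_prob_eq_one` (a pure state: `ρ² = ρ`, `Tr ρ = 1`);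
* the **estimator** `est ρ σ S = χ_σ(S)/χ_ρ(S)` (eq. (4) "X = χ_σ(k)/χ_ρ(k)") and its mean
  `expect_est`: `Σ_S Pr(S) X(S) = Tr(ρσ)` ("It is easy to see that 𝔼X = Tr(ρσ)"; E-46's (S41)/(S42));
* Appendix A: `expect_est_sq_le` (`𝔼X² ≤ Σ_S χ_σ(S)² = Tr(σ²)`), `purity_le_one` (`Tr(σ²) ≤ 1` for a
  density matrix, by the spectral theorem), the variance `variance ρ σ = Σ_S Pr(S)(X(S) − Tr(ρσ))²`
  with `variance_eq` (`= 𝔼X² − Tr(ρσ)²`) and **`variance_le_one`** (Appendix A: `Var(X_i) ≤ 1`), and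
  the Chebyshev count `settings_chebyshev` (`ℓ ≥ 1/(ε²δ) ⇒ (Var ≤ 1)/ (ℓε²) ≤ δ`);
* "Well-conditioned states": `WellConditioned ρ α` ("for all k, either Tr(ρ W_k) = 0 or
  |Tr(ρ W_k)| ≥ α"), `norm_trace_mul_pauliString_le_one` (`|Tr(σ W)| ≤ 1` for a density matrix —
  E-46 §S3.3 "Since |Tr(P σ)| ≤ 1"), **`abs_est_le`** ("the estimator X is bounded: |X| ≤ 1/α") and
  the Hoeffding count `settings_hoeffding` (`2 exp(−ℓ α² ε²/2) ≤ δ ⇔ ℓ ≥ 2 log(2/δ)/(α² ε²)`, the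
  "ℓ = O(log(1/δ)/(α²ε²))" of the text; stabilizer states have `α = 1`);
* the copies per setting `copies` (eq. (6) "m_i = ⌈2 log(2/δ)/(d χ_ρ(k_i)² ℓ ε²)⌉"), the certain bound
  `copies_le_of_wellConditioned` ("m_i ≤ 1 + 2 log(2/δ)/(α² ℓ ε²)") and the expected-copies bound
  **`expect_copies_le`** (eq. (9) "𝔼(m_i) = Σ_k χ_ρ(k)² m_k ≤ 1 + 2d log(2/δ)/(ℓ ε²)").

READING NOTE. Appendix A prints the second line of its `Var(X_i)` display as an equality
`𝔼(X_i²) − (𝔼X_i)² = Σ_k [χ_σ(k)]² − [Tr(ρσ)]²`; the sum defining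
`𝔼(X_i²)` only runs over the support of `χ_ρ`, so in general it is `≤ Σ_k χ_σ(k)² = Tr(σ²)` (equality
when `χ_σ` vanishes off that support) — the inequality is all that the conclusion `Var(X_i) ≤ 1` uses, and it is
what `expect_est_sq_le` states.

Not covered here: the probabilistic statements themselves (Chebyshev / Hoeffding tails for the
sampled `k_1 … k_ℓ` and the shots `A_ij` — only their printed parameter arithmetic is fixed), the
finite-shot estimator `Ỹ` and eqs. (5), (7), (8), (10), the truncation of bad events, the `Ω(d²/log d)`
tomography lower bound, the channel version, and E-46's readout-mitigated / T-doped variants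
(S43), §S3.4. The STABILIZER special case (uniform sampling over the stabilizer group, generator
bound) is the sibling file `StabilizerFidelityEstimation.lean`.

'instance-level adjudication of specific advantage claims; no claim about BQP vs BPP or the summit' —
nothing here asserts anything about a device or about the value `F₁ = 0.32(1)` of E-46.

## References

* [FlammiaLiu2011] S. T. Flammia, Y.-K. Liu, Phys. Rev. Lett. 106, 230501 (2011), arXiv:1104.4695 —
  eqs. (1)–(6), (9); "Well-conditioned states"; Appendix A ("Bounding the Failure Probabilities": the
  `Var(X_i)` display and "set λ = 1/√δ and ℓ = ⌈1/(ε²δ)⌉"). Equation numbers follow the printed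
  order of the numbered displays ((1) `F = Tr(ρσ)`, (2) the expansion, (3) `Pr(k)`, (4) `X`, (5) the
  Chebyshev statement, (6) `m_i`, (7) `X̃_i`, (8) the Hoeffding statement, (9) `𝔼(m_i)`, (10) `𝔼(m)`);
  line locators `p000N` refer to the 3000-character chunks of the held text `paper:arxiv-1104.4695`.
* [MartielEtAl2026] S. Martiel et al., arXiv:2607.25941 (2026) — p2; SI §S3.1 (S41)–(S42), §S3.3.
* [NielsenChuang2010] for `Tr ρ² ≤ 1` (density operators, Thm 2.5 / Ex. 2.71), via the tree's
  `Literature.InformationTheory.Entropy.eigenvalues_le_one`.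

## Mathlib / tree search

`find lean/Literature -iname '*fidelity*'` → only `StabilizerFidelityEstimation.lean` (stabilizer
case), `PostselectedFidelityBound.lean` (E-46's F₁ ⇒ F₂ certificate), truncation-fidelity files;
`grep -ril 'FlammiaLiu|direct fidelity'` over `Literature/` → no general estimator. Reused:
`PauliPath.trace_mul_eq_inv_mul_sum` (resolution of the identity), `pauliCoeff_pauliString` /
`trace_pauliString_mul_pauliString` (orthogonality), `conjTranspose_pauliString`,
`pauliString_mul_self`, `Matrix.IsHermitian.spectral_theorem`, `Entropy.eigenvalues_le_one`,
`Entropy.sum_eigenvalues_eq_one`.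
-/

noncomputable section

open Matrix Finset Literature.Computability.QuantumComplexity
open Literature.Computability.QuantumComplexity.PauliPath
open scoped ComplexOrder MatrixOrder

namespace Literature.InformationTheory.QuantumLearning

namespace DFE

variable {ι : Type*} [Fintype ι] [DecidableEq ι]

/-! ### Dimension and characteristic function -/

/-- `√d` for `d = 2^{|ι|}` ("Hilbert space dimension d = 2ⁿ"). [cite: FlammiaLiu2011, p0002 ("Consider a system of n qubits, with Hilbert space dimension d = 2^n")] -/
def sqrtDim (ι : Type*) [Fintype ι] : ℝ := Real.sqrt ((2 : ℝ) ^ Fintype.card ι)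

omit [DecidableEq ι] in
/-- `√d > 0`. [cite: FlammiaLiu2011, p0002 (d = 2^n)] -/
theorem sqrtDim_pos : 0 < sqrtDim ι := Real.sqrt_pos.mpr (by positivity)

omit [DecidableEq ι] in
/-- `(√d)² = d = 2^{|ι|}`. [cite: FlammiaLiu2011, p0002 (d = 2^n)] -/
theorem sqrtDim_sq : sqrtDim ι ^ 2 = (2 : ℝ) ^ Fintype.card ι :=
  Real.sq_sqrt (by positivity)

omit [DecidableEq ι] in
/-- `(√d)·(√d) = 2^{|ι|}`. [cite: FlammiaLiu2011, p0002 (d = 2^n)] -/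
theorem sqrtDim_mul_self : sqrtDim ι * sqrtDim ι = (2 : ℝ) ^ Fintype.card ι := by
  rw [← sq]; exact sqrtDim_sq

/-- The **characteristic function** `χ_ρ(S) = Tr(ρ W_S)/√d` of an operator `ρ` at the Pauli string
`W_S` (real part of `Tr(W_S ρ) = Tr(ρ W_S)`; for Hermitian `ρ` the trace is real, `ofReal_charFn`).
[cite: FlammiaLiu2011, p0002 ("Define the characteristic function χ_ρ(k) = Tr(ρ W_k/√d)")] -/
def charFn (ρ : Matrix (ι → Bool) (ι → Bool) ℂ) (S : ι → Pauli) : ℝ :=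
  (pauliCoeff ρ S).re / sqrtDim ι

/-- Unfolding of `charFn`. [cite: FlammiaLiu2011, p0002 (definition of χ_ρ)] -/
theorem charFn_eq (ρ : Matrix (ι → Bool) (ι → Bool) ℂ) (S : ι → Pauli) :
    charFn ρ S = (pauliString S * ρ).trace.re / sqrtDim ι := rfl

/-- For Hermitian `ρ` the Pauli expectation `Tr(W_S ρ)` is real (`W_S` is Hermitian).
[cite: FlammiaLiu2011, p0002 (Pauli observables W_k; χ_ρ real-valued)] -/
theorem star_pauliCoeff_of_isHermitian {ρ : Matrix (ι → Bool) (ι → Bool) ℂ} (hρ : ρ.IsHermitian)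
    (S : ι → Pauli) : star (pauliCoeff ρ S) = pauliCoeff ρ S := by
  rw [pauliCoeff_eq, ← Matrix.trace_conjTranspose, Matrix.conjTranspose_mul, hρ.eq,
    conjTranspose_pauliString, Matrix.trace_mul_comm]

/-- For Hermitian `ρ`: `(χ_ρ(S) : ℂ) = Tr(W_S ρ)/√d`. [cite: FlammiaLiu2011, p0002 (definition of χ_ρ)] -/
theorem ofReal_charFn {ρ : Matrix (ι → Bool) (ι → Bool) ℂ} (hρ : ρ.IsHermitian) (S : ι → Pauli) :
    ((charFn ρ S : ℝ) : ℂ) = pauliCoeff ρ S / (sqrtDim ι : ℂ) := by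
  have hre : ((pauliCoeff ρ S).re : ℂ) = pauliCoeff ρ S := by
    have := star_pauliCoeff_of_isHermitian hρ S
    rw [Complex.star_def] at this
    exact Complex.conj_eq_iff_re.mp this
  rw [charFn, Complex.ofReal_div, hre]

/-- `Tr(W_S ρ) = √d · χ_ρ(S)` for Hermitian `ρ`. [cite: FlammiaLiu2011, p0002 (definition of χ_ρ)] -/
theorem pauliCoeff_eq_sqrtDim_mul_charFn {ρ : Matrix (ι → Bool) (ι → Bool) ℂ} (hρ : ρ.IsHermitian)
    (S : ι → Pauli) : pauliCoeff ρ S = (sqrtDim ι : ℂ) * (charFn ρ S : ℂ) := by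
  have h0 : (sqrtDim ι : ℂ) ≠ 0 := Complex.ofReal_ne_zero.mpr sqrtDim_pos.ne'
  rw [ofReal_charFn hρ, mul_div_cancel₀ _ h0]

/-! ### Eq. (2): the fidelity as a sum over characteristic functions -/

/-- **Eq. (2)** (complex form): for Hermitian `ρ, σ`,
`Tr(ρσ) = Σ_S χ_ρ(S) χ_σ(S)` — from the resolution of the identity in the Pauli basis
`Tr(ρσ) = (1/d) Σ_S Tr(ρ W_S) Tr(W_S σ)`.
[cite: FlammiaLiu2011, eq. (2) p0002 ("Tr(ρσ) = Σ_k χ_ρ(k) χ_σ(k)")] -/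
theorem trace_mul_eq_sum_charFn' {ρ σ : Matrix (ι → Bool) (ι → Bool) ℂ} (hρ : ρ.IsHermitian)
    (hσ : σ.IsHermitian) :
    (ρ * σ).trace = ∑ S : ι → Pauli, ((charFn ρ S * charFn σ S : ℝ) : ℂ) := by
  have h0 : (sqrtDim ι : ℂ) ≠ 0 := Complex.ofReal_ne_zero.mpr sqrtDim_pos.ne'
  have hd : ((2 : ℂ) ^ Fintype.card ι) = (sqrtDim ι : ℂ) * (sqrtDim ι : ℂ) := by
    rw [← Complex.ofReal_mul, sqrtDim_mul_self]; push_cast; ring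
  rw [trace_mul_eq_inv_mul_sum ρ σ, Finset.mul_sum]
  refine Finset.sum_congr rfl fun S _ => ?_
  rw [Complex.ofReal_mul, ofReal_charFn hρ, ofReal_charFn hσ,
    show (ρ * pauliString S).trace = pauliCoeff ρ S by rw [pauliCoeff_eq, Matrix.trace_mul_comm], hd]
  field_simp

/-- **Eq. (2)**: for Hermitian `ρ, σ`, `Tr(ρσ) = Σ_S χ_ρ(S) χ_σ(S)` (as a real number; `Tr(ρσ)` is
real). [cite: FlammiaLiu2011, eq. (2) p0002 ("Tr(ρσ) = Σ_k χ_ρ(k) χ_σ(k)")] -/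
theorem trace_mul_eq_sum_charFn {ρ σ : Matrix (ι → Bool) (ι → Bool) ℂ} (hρ : ρ.IsHermitian)
    (hσ : σ.IsHermitian) :
    (ρ * σ).trace.re = ∑ S : ι → Pauli, charFn ρ S * charFn σ S := by
  rw [trace_mul_eq_sum_charFn' hρ hσ, ← Complex.ofReal_sum, Complex.ofReal_re]

/-- For Hermitian `ρ, σ` the overlap `Tr(ρσ)` is real. [cite: FlammiaLiu2011, eq. (2)] -/
theorem trace_mul_im_eq_zero {ρ σ : Matrix (ι → Bool) (ι → Bool) ℂ} (hρ : ρ.IsHermitian)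
    (hσ : σ.IsHermitian) : (ρ * σ).trace.im = 0 := by
  rw [trace_mul_eq_sum_charFn' hρ hσ, ← Complex.ofReal_sum, Complex.ofReal_im]

/-! ### Eq. (3): the relevance distribution -/

/-- The **relevance distribution** `Pr(S) = χ_ρ(S)²` over Pauli strings.
[cite: FlammiaLiu2011, eq. (3) p0002 ("Select k ∈ {1,…,d²} at random with probability Pr(k) = (χ_ρ(k))²")]; [cite: MartielEtAl2026, SI §S3.1 eq. (S41) ("p(P) = χ_ρ(P)²")] -/
def prob (ρ : Matrix (ι → Bool) (ι → Bool) ℂ) (S : ι → Pauli) : ℝ := charFn ρ S ^ 2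

/-- Unfolding of `prob`. [cite: FlammiaLiu2011, eq. (3)] -/
theorem prob_eq (ρ : Matrix (ι → Bool) (ι → Bool) ℂ) (S : ι → Pauli) : prob ρ S = charFn ρ S ^ 2 := rfl

/-- `Pr(S) ≥ 0`. [cite: FlammiaLiu2011, eq. (3)] -/
theorem prob_nonneg (ρ : Matrix (ι → Bool) (ι → Bool) ℂ) (S : ι → Pauli) : 0 ≤ prob ρ S := sq_nonneg _

/-- `Pr(S) = 0` exactly when `χ_ρ(S) = 0` ("supported on Paulis with χ_ρ(P) ≠ 0").
[cite: MartielEtAl2026, SI §S3.1 eq. (S41)] -/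
theorem prob_eq_zero_iff (ρ : Matrix (ι → Bool) (ι → Bool) ℂ) (S : ι → Pauli) :
    prob ρ S = 0 ↔ charFn ρ S = 0 := by
  rw [prob_eq]; exact pow_eq_zero_iff two_ne_zero

/-- Normalisation: `Σ_S χ_ρ(S)² = Tr(ρ²)` for Hermitian `ρ` (eq. (2) with `σ = ρ`).
[cite: FlammiaLiu2011, eqs. (2)–(3)] -/
theorem sum_prob_eq {ρ : Matrix (ι → Bool) (ι → Bool) ℂ} (hρ : ρ.IsHermitian) :
    ∑ S : ι → Pauli, prob ρ S = (ρ * ρ).trace.re := by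
  rw [trace_mul_eq_sum_charFn hρ hρ]
  exact Finset.sum_congr rfl fun S _ => sq _

/-- For a pure state (`ρ² = ρ`, `Tr ρ = 1`) the relevance distribution is a probability distribution:
`Σ_S χ_ρ(S)² = 1`. [cite: MartielEtAl2026, SI §S3.1 ("Since ρ is pure, Σ_{P∈Pⁿ} χ_ρ(P)² = 1")];
[cite: FlammiaLiu2011, eqs. (1)–(3)] -/
theorem sum_prob_eq_one {ρ : Matrix (ι → Bool) (ι → Bool) ℂ} (hρ : ρ.IsHermitian)
    (hpure : ρ * ρ = ρ) (htr : ρ.trace = 1) : ∑ S : ι → Pauli, prob ρ S = 1 := by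
  rw [sum_prob_eq hρ, hpure, htr, Complex.one_re]

/-! ### Eq. (4): the estimator and its mean -/

/-- The single-setting **estimator** `X(S) = χ_σ(S)/χ_ρ(S)` (value `0` where `χ_ρ(S) = 0`, a set of
probability zero). [cite: FlammiaLiu2011, eq. (4) p0003 ("We then construct the estimator X = χ_σ(k)/χ_ρ(k)")]; [cite: MartielEtAl2026, SI §S3.1 eq. (S41)] -/
def est (ρ σ : Matrix (ι → Bool) (ι → Bool) ℂ) (S : ι → Pauli) : ℝ := charFn σ S / charFn ρ S

/-- Unfolding of `est`. [cite: FlammiaLiu2011, eq. (4)] -/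
theorem est_eq (ρ σ : Matrix (ι → Bool) (ι → Bool) ℂ) (S : ι → Pauli) :
    est ρ σ S = charFn σ S / charFn ρ S := rfl

/-- Pointwise: `Pr(S) · X(S) = χ_ρ(S) χ_σ(S)` (both sides vanish where `χ_ρ(S) = 0`).
[cite: FlammiaLiu2011, eqs. (3)–(4)] -/
theorem prob_mul_est (ρ σ : Matrix (ι → Bool) (ι → Bool) ℂ) (S : ι → Pauli) :
    prob ρ S * est ρ σ S = charFn ρ S * charFn σ S := by
  rw [prob_eq, est_eq]
  by_cases h : charFn ρ S = 0
  · rw [h]; simp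
  · field_simp

/-- **`𝔼X = Tr(ρσ)`**: the mean of the estimator over the relevance distribution is the fidelity
with the pure target, `Σ_S Pr(S) X(S) = Tr(ρσ)`, for Hermitian `ρ, σ`.
[cite: FlammiaLiu2011, p0003 ("It is easy to see that 𝔼X = Tr(ρσ)")];
[cite: MartielEtAl2026, SI §S3.1 eqs. (S41)–(S42) ("F(ρ, σ) = E_{P∼p}[χ_σ(P)/χ_ρ(P)] … E[F̂] = F(ρ, σ)")] -/
theorem expect_est {ρ σ : Matrix (ι → Bool) (ι → Bool) ℂ} (hρ : ρ.IsHermitian) (hσ : σ.IsHermitian) :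
    ∑ S : ι → Pauli, prob ρ S * est ρ σ S = (ρ * σ).trace.re := by
  rw [trace_mul_eq_sum_charFn hρ hσ]
  exact Finset.sum_congr rfl fun S _ => prob_mul_est ρ σ S

/-! ### Appendix A: second moment, purity, variance, Chebyshev count -/

/-- Pointwise second moment: `Pr(S) · X(S)² ≤ χ_σ(S)²` (equality where `χ_ρ(S) ≠ 0`, and `0 ≤ χ_σ²`
elsewhere). [cite: FlammiaLiu2011, Appendix A (Var(X_i) display, second line)] -/
theorem prob_mul_est_sq_le (ρ σ : Matrix (ι → Bool) (ι → Bool) ℂ) (S : ι → Pauli) :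
    prob ρ S * est ρ σ S ^ 2 ≤ charFn σ S ^ 2 := by
  rw [prob_eq, est_eq]
  by_cases h : charFn ρ S = 0
  · rw [h]; simp [sq_nonneg]
  · rw [div_pow, mul_div_cancel₀ _ (pow_ne_zero 2 h)]

/-- `𝔼X² ≤ Σ_S χ_σ(S)² = Tr(σ²)` for Hermitian `σ` (printed as an equality; see the READING NOTE in the
module docstring). [cite: FlammiaLiu2011, Appendix A (Var(X_i) display, lines 2–3: "= Σ_k [χ_σ(k)]² − [Tr(ρσ)]² = Tr(σ²) − [Tr(ρσ)]²")] -/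
theorem expect_est_sq_le (ρ : Matrix (ι → Bool) (ι → Bool) ℂ) {σ : Matrix (ι → Bool) (ι → Bool) ℂ}
    (hσ : σ.IsHermitian) :
    ∑ S : ι → Pauli, prob ρ S * est ρ σ S ^ 2 ≤ (σ * σ).trace.re := by
  rw [← sum_prob_eq hσ]
  exact Finset.sum_le_sum fun S _ => prob_mul_est_sq_le ρ σ S

/-- **Purity of a density matrix is at most one**: `Tr(σ²) ≤ 1` for `σ ⪰ 0`, `Tr σ = 1` (spectral
theorem: `Tr(σ²) = Σ_i λ_i²` with `0 ≤ λ_i ≤ 1`, `Σ_i λ_i = 1`).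
[cite: NielsenChuang2010, Thm 2.5 and Ex. 2.71 ("tr(ρ²) ≤ 1")]; [cite: FlammiaLiu2011, Appendix A (Var(X_i) display, third line: "Tr(σ²) − [Tr(ρσ)]² ≤ 1")] -/
theorem purity_le_one {σ : Matrix (ι → Bool) (ι → Bool) ℂ} (hσ : σ.PosSemidef) (htr : σ.trace = 1) :
    (σ * σ).trace.re ≤ 1 := by
  have hH : σ.IsHermitian := hσ.1
  have hHeq := hH.spectral_theorem
  rw [Unitary.conjStarAlgAut_apply] at hHeq
  set V : Matrix (ι → Bool) (ι → Bool) ℂ := (hH.eigenvectorUnitary : Matrix (ι → Bool) (ι → Bool) ℂ)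
    with hVdef
  have hVV : star V * V = 1 := Unitary.coe_star_mul_self hH.eigenvectorUnitary
  set Λ : Matrix (ι → Bool) (ι → Bool) ℂ := diagonal (RCLike.ofReal ∘ hH.eigenvalues) with hΛ
  have hΛ' : Λ = diagonal (fun i => ((hH.eigenvalues i : ℝ) : ℂ)) := by rw [hΛ]; rfl
  -- `Tr(σ²) = Tr(Λ²)`
  have htr2 : (σ * σ).trace = (Λ * Λ).trace := by
    rw [hHeq]
    calc (V * Λ * star V * (V * Λ * star V)).trace
        = (V * (Λ * (star V * V) * Λ * star V)).trace := by simp only [Matrix.mul_assoc]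
      _ = (V * (Λ * Λ * star V)).trace := by rw [hVV, Matrix.mul_one]
      _ = (Λ * Λ * star V * V).trace := by rw [Matrix.trace_mul_comm, Matrix.mul_assoc]
      _ = (Λ * Λ).trace := by rw [Matrix.mul_assoc, hVV, Matrix.mul_one]
  rw [htr2, hΛ', diagonal_mul_diagonal, trace_diagonal]
  simp only [← Complex.ofReal_mul, ← Complex.ofReal_sum, Complex.ofReal_re]
  calc ∑ i, hH.eigenvalues i * hH.eigenvalues i ≤ ∑ i, hH.eigenvalues i :=
        Finset.sum_le_sum fun i _ => mul_le_of_le_one_left (hσ.eigenvalues_nonneg i)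
          (Entropy.eigenvalues_le_one hσ htr i)
    _ = 1 := Entropy.sum_eigenvalues_eq_one hH htr

/-- The **variance** of the single-setting estimator over the relevance distribution,
`Var(X) = Σ_S Pr(S) (X(S) − Tr(ρσ))²`. [cite: FlammiaLiu2011, Appendix A ("observe that the variance of each individual estimator X_i is not too large, Var(X_i) = 𝔼(X_i²) − (𝔼X_i)²")] -/
def variance (ρ σ : Matrix (ι → Bool) (ι → Bool) ℂ) : ℝ :=
  ∑ S : ι → Pauli, prob ρ S * (est ρ σ S - (ρ * σ).trace.re) ^ 2

/-- `Var(X) = 𝔼X² − (𝔼X)²` for a pure Hermitian target `ρ` and Hermitian `σ`.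
[cite: FlammiaLiu2011, Appendix A (Var(X_i) display, first line)] -/
theorem variance_eq {ρ σ : Matrix (ι → Bool) (ι → Bool) ℂ} (hρ : ρ.IsHermitian) (hpure : ρ * ρ = ρ)
    (htr : ρ.trace = 1) (hσ : σ.IsHermitian) :
    variance ρ σ = ∑ S : ι → Pauli, prob ρ S * est ρ σ S ^ 2 - (ρ * σ).trace.re ^ 2 := by
  set F := (ρ * σ).trace.re with hF
  have h1 := expect_est hρ hσ
  have h2 := sum_prob_eq_one hρ hpure htr
  have hexp : ∀ S : ι → Pauli, prob ρ S * (est ρ σ S - F) ^ 2 =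
      prob ρ S * est ρ σ S ^ 2 - 2 * F * (prob ρ S * est ρ σ S) + F ^ 2 * prob ρ S := fun S => by ring
  rw [variance, ← hF]
  simp only [hexp, Finset.sum_add_distrib, Finset.sum_sub_distrib, ← Finset.mul_sum, h1, h2, ← hF]
  ring

/-- `Var(X) ≤ Tr(σ²) − Tr(ρσ)²`. [cite: FlammiaLiu2011, Appendix A (Var(X_i) display: "= Tr(σ²) − [Tr(ρσ)]²")] -/
theorem variance_le_purity_sub_sq {ρ σ : Matrix (ι → Bool) (ι → Bool) ℂ} (hρ : ρ.IsHermitian)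
    (hpure : ρ * ρ = ρ) (htr : ρ.trace = 1) (hσ : σ.IsHermitian) :
    variance ρ σ ≤ (σ * σ).trace.re - (ρ * σ).trace.re ^ 2 := by
  rw [variance_eq hρ hpure htr hσ]
  exact sub_le_sub_right (expect_est_sq_le ρ hσ) _

/-- **`Var(X_i) ≤ 1`** when the target `ρ` is a pure state and `σ` is a density matrix ("This implies
that Var(Y) ≤ 1/ℓ"). [cite: FlammiaLiu2011, Appendix A (Var(X_i) display: "= Tr(σ²) − [Tr(ρσ)]² ≤ 1")] -/
theorem variance_le_one {ρ σ : Matrix (ι → Bool) (ι → Bool) ℂ} (hρ : ρ.IsHermitian)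
    (hpure : ρ * ρ = ρ) (htr : ρ.trace = 1) (hσ : σ.PosSemidef) (hσtr : σ.trace = 1) :
    variance ρ σ ≤ 1 := by
  have h := variance_le_purity_sub_sq hρ hpure htr hσ.1
  have hp := purity_le_one hσ hσtr
  nlinarith [sq_nonneg (ρ * σ).trace.re]

/-- The Chebyshev count of settings: with `Var(X_i) ≤ 1`, `Var(Y) ≤ 1/ℓ` for the mean `Y` of `ℓ`
independent settings, and Chebyshev's bound `Var(Y)/ε² ≤ 1/(ℓ ε²)` is `≤ δ` as soon as
`ℓ ≥ 1/(ε²δ)` ("We repeat the above process ℓ = ⌈1/(ε²δ)⌉ times … By Chebyshev's inequality,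
Pr[|Y − Tr(ρσ)| ≥ ε] ≤ δ"); only this parameter arithmetic is formalised.
[cite: FlammiaLiu2011, p0003 (ℓ = ⌈1/(ε²δ)⌉) and Appendix A ("set λ = 1/√δ and ℓ = ⌈1/(ε²δ)⌉")] -/
theorem settings_chebyshev {ℓ ε δ : ℝ} (hε : 0 < ε) (hδ : 0 < δ) (hℓ : 1 / (ε ^ 2 * δ) ≤ ℓ) :
    1 / (ℓ * ε ^ 2) ≤ δ := by
  have hε2 : 0 < ε ^ 2 := by positivity
  have hℓpos : 0 < ℓ := lt_of_lt_of_le (by positivity) hℓ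
  rw [div_le_iff₀ (by positivity)]
  rw [div_le_iff₀ (by positivity)] at hℓ
  nlinarith

/-! ### Well-conditioned states: bounded estimator and the Hoeffding count -/

/-- A state is **well-conditioned with parameter `α`** when every Pauli expectation is either `0`
or at least `α` in absolute value. [cite: FlammiaLiu2011, p0003 ("We say that a state ρ is well-conditioned with parameter α if for all k, either Tr(ρ W_k) = 0 or |Tr(ρ W_k)| ≥ α")] -/
def WellConditioned (ρ : Matrix (ι → Bool) (ι → Bool) ℂ) (α : ℝ) : Prop :=
  ∀ S : ι → Pauli, pauliCoeff ρ S = 0 ∨ α ≤ ‖pauliCoeff ρ S‖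

/-- `0 ≤ Tr(σX)` for positive semidefinite `σ` and `X` (through `σ = BᴴB`, Mathlib's matrix star
order). [folklore] -/
private theorem trace_mul_nonneg_of_posSemidef {σ X : Matrix (ι → Bool) (ι → Bool) ℂ}
    (hσ : σ.PosSemidef) (hX : X.PosSemidef) : 0 ≤ (σ * X).trace := by
  obtain ⟨B, hB⟩ : ∃ B : Matrix (ι → Bool) (ι → Bool) ℂ, σ = Bᴴ * B := by
    obtain ⟨T, hT, -, hTT⟩ :=
      CFC.exists_sqrt_of_isSelfAdjoint_of_quasispectrumRestricts hσ.isHermitian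
        (QuasispectrumRestricts.nnreal_of_nonneg hσ.nonneg)
    exact ⟨T, by rw [← hTT, ← star_eq_conjTranspose, hT.star_eq]⟩
  rw [hB, Matrix.mul_assoc, Matrix.trace_mul_comm]
  exact (hX.mul_mul_conjTranspose_same B).trace_nonneg

/-- `½(1 ± W_S)` is positive semidefinite (`W_S` is a Hermitian involution, so `½(1 ± W_S)` is an
orthogonal projection `P = PᴴP`). [folklore] -/
private theorem posSemidef_half_one_add_smul_pauliString (S : ι → Pauli) {s : ℂ} (hs : s = 1 ∨ s = -1) :
    ((1 / 2 : ℂ) • (1 + s • pauliString S)).PosSemidef := by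
  set P : Matrix (ι → Bool) (ι → Bool) ℂ := (1 / 2 : ℂ) • (1 + s • pauliString S) with hP
  have hss : s * s = 1 := by rcases hs with rfl | rfl <;> norm_num
  have hsstar : star s = s := by rcases hs with rfl | rfl <;> simp
  have hherm : Pᴴ = P := by
    rw [hP, conjTranspose_smul, conjTranspose_add, conjTranspose_one, conjTranspose_smul,
      conjTranspose_pauliString, hsstar]
    norm_num
  have hidem : P * P = P := by
    rw [hP, smul_mul_smul_comm, add_mul, mul_add, mul_add, one_mul, mul_one, one_mul,
      smul_mul_smul_comm, pauliString_mul_self, hss, one_smul]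
    rw [show (1 : Matrix (ι → Bool) (ι → Bool) ℂ) + s • pauliString S + (s • pauliString S + 1) =
      (2 : ℂ) • (1 + s • pauliString S) by rw [two_smul]; abel, smul_smul]
    norm_num
  have h : P = Pᴴ * P := by rw [hherm, hidem]
  rw [h]
  exact posSemidef_conjTranspose_mul_self P

/-- **Pauli expectations of a density matrix are bounded by one**: `|Tr(σ W_S)| ≤ 1` for `σ ⪰ 0`,
`Tr σ = 1` (from `Tr(σ ½(1 ± W_S)) ≥ 0`; this discharges, for density matrices, the hypothesis
`∀ S, ‖pauliCoeff ρ S‖ ≤ 1` of the tree's `PauliPropagation.norm_trace_sub_truncateTo_mul_le`).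
[cite: MartielEtAl2026, SI §S3.3 ("Since |Tr(P σ)| ≤ 1, this random variable is bounded by B_ρ")];
[cite: FlammiaLiu2011, p0003 ("the estimator X is bounded: |X| ≤ 1/α")] -/
theorem norm_trace_mul_pauliString_le_one {σ : Matrix (ι → Bool) (ι → Bool) ℂ} (hσ : σ.PosSemidef)
    (htr : σ.trace = 1) (S : ι → Pauli) : ‖pauliCoeff σ S‖ ≤ 1 := by
  -- `Tr(W σ)` is real
  have hreal : ((pauliCoeff σ S).re : ℂ) = pauliCoeff σ S := by
    have := star_pauliCoeff_of_isHermitian hσ.1 S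
    rw [Complex.star_def] at this
    exact Complex.conj_eq_iff_re.mp this
  -- `0 ≤ Tr(σ ½(1 + s W)) = ½(1 + s Tr(Wσ))` for `s = ±1`
  have key : ∀ s : ℂ, s = 1 ∨ s = -1 → 0 ≤ (1 + s * pauliCoeff σ S).re := by
    intro s hs
    have h := trace_mul_nonneg_of_posSemidef hσ (posSemidef_half_one_add_smul_pauliString S hs)
    rw [Matrix.mul_smul, Matrix.trace_smul, Matrix.mul_add, Matrix.mul_one, Matrix.trace_add, htr,
      Matrix.mul_smul, Matrix.trace_smul, smul_eq_mul, smul_eq_mul,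
      show (σ * pauliString S).trace = pauliCoeff σ S by rw [pauliCoeff_eq, Matrix.trace_mul_comm]] at h
    have h' := (Complex.nonneg_iff.mp h).1
    simp only [Complex.mul_re] at h'
    have : ((1 : ℂ) / 2).im = 0 := by norm_num
    rw [this, zero_mul, sub_zero, show ((1 : ℂ) / 2).re = 1 / 2 by norm_num] at h'
    linarith
  have h1 := key 1 (Or.inl rfl)
  have h2 := key (-1) (Or.inr rfl)
  rw [one_mul, Complex.add_re, Complex.one_re] at h1
  rw [neg_one_mul, Complex.add_re, Complex.one_re, Complex.neg_re] at h2
  rw [← hreal, Complex.norm_real, Real.norm_eq_abs, abs_le]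
  exact ⟨by linarith, by linarith⟩

/-- For Hermitian `ρ`: `‖Tr(W_S ρ)‖ = √d · |χ_ρ(S)|`. [cite: FlammiaLiu2011, p0002 (definition of χ_ρ)] -/
theorem norm_pauliCoeff_eq {ρ : Matrix (ι → Bool) (ι → Bool) ℂ} (hρ : ρ.IsHermitian) (S : ι → Pauli) :
    ‖pauliCoeff ρ S‖ = sqrtDim ι * |charFn ρ S| := by
  rw [pauliCoeff_eq_sqrtDim_mul_charFn hρ, norm_mul, Complex.norm_real, Complex.norm_real,
    Real.norm_eq_abs, Real.norm_eq_abs, abs_of_pos sqrtDim_pos]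

/-- **"The estimator X is bounded: |X| ≤ 1/α"** for a well-conditioned Hermitian target `ρ` and a
density matrix `σ`. [cite: FlammiaLiu2011, p0003 ("Note first that the estimator X is bounded: |X| ≤ 1/α")];
[cite: MartielEtAl2026, SI §S3.3 (X_P bounded by B_ρ = max 1/(√d |χ_ρ(P)|))] -/
theorem abs_est_le {ρ σ : Matrix (ι → Bool) (ι → Bool) ℂ} {α : ℝ} (hρ : ρ.IsHermitian)
    (hwc : WellConditioned ρ α) (hα : 0 < α) (hσ : σ.PosSemidef) (hσtr : σ.trace = 1)
    (S : ι → Pauli) : |est ρ σ S| ≤ 1 / α := by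
  rw [est_eq, abs_div]
  rcases hwc S with h0 | hle
  · -- `χ_ρ(S) = 0`: the estimator is `0` there
    have : charFn ρ S = 0 := by rw [charFn, h0, Complex.zero_re, zero_div]
    rw [this, abs_zero, div_zero]
    positivity
  · have hb := norm_trace_mul_pauliString_le_one hσ hσtr S
    rw [norm_pauliCoeff_eq hρ] at hle
    rw [norm_pauliCoeff_eq hσ.1] at hb
    have hpos : 0 < |charFn ρ S| := by
      by_contra hc
      push Not at hc
      have : sqrtDim ι * |charFn ρ S| ≤ 0 := by
        have := le_antisymm hc (abs_nonneg _); rw [this, mul_zero]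
      linarith
    rw [div_le_div_iff₀ hpos hα, one_mul]
    have hd := sqrtDim_pos (ι := ι)
    -- `α |χ_σ| √d ≤ √d|χ_ρ| · 1`
    nlinarith [abs_nonneg (charFn σ S)]

/-- The Hoeffding count of settings for a bounded estimator `|X| ≤ 1/α`: the two-sided Hoeffding
tail `2 exp(−2ℓε²/(2/α)²) = 2 exp(−ℓ α² ε²/2)` for the mean of `ℓ` samples in `[−1/α, 1/α]` is `≤ δ`
exactly when `ℓ ≥ 2 log(2/δ)/(α² ε²)` — the "ℓ = O(log(1/δ)/(α²ε²))" of the text (stabilizer states: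
`α = 1`); the probabilistic inequality itself is not formalised here.
[cite: FlammiaLiu2011, p0003 ("we can choose the number of measurement settings to be ℓ = O(log(1/δ)/(α²ε²))")];
[cite: MartielEtAl2026, SI §S3.3 ("Hoeffding's inequality gives L = O(B_ρ² log(1/δ)/ε²)")] -/
theorem settings_hoeffding {ℓ ε δ α : ℝ} (hε : 0 < ε) (hδ : 0 < δ) (hα : 0 < α) :
    2 * Real.exp (-(ℓ * α ^ 2 * ε ^ 2) / 2) ≤ δ ↔ 2 * Real.log (2 / δ) / (α ^ 2 * ε ^ 2) ≤ ℓ := by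
  have hε2 : 0 < α ^ 2 * ε ^ 2 := by positivity
  rw [div_le_iff₀ hε2, Real.log_div (by norm_num) hδ.ne']
  constructor
  · intro h
    have h1 : Real.exp (-(ℓ * α ^ 2 * ε ^ 2) / 2) ≤ δ / 2 := by linarith
    have h2 := (Real.le_log_iff_exp_le (by positivity)).mpr h1
    rw [Real.log_div hδ.ne' (by norm_num)] at h2
    nlinarith
  · intro h
    have h1 : -(ℓ * α ^ 2 * ε ^ 2) / 2 ≤ Real.log (δ / 2) := by
      rw [Real.log_div hδ.ne' (by norm_num)]
      nlinarith
    have h2 := (Real.le_log_iff_exp_le (by positivity)).mp h1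
    linarith

/-! ### Eqs. (6), (9): copies of `σ` per setting -/

/-- Copies of `σ` measured at setting `S`: `m_S = ⌈2 log(2/δ)/(d χ_ρ(S)² ℓ ε²)⌉`.
[cite: FlammiaLiu2011, eq. (6) p0003 ("m_i = ⌈2/(d χ_ρ(k_i)² ℓ ε²) log(2/δ)⌉")] -/
def copies (ρ : Matrix (ι → Bool) (ι → Bool) ℂ) (ℓ ε δ : ℝ) (S : ι → Pauli) : ℕ :=
  ⌈2 * Real.log (2 / δ) / ((2 : ℝ) ^ Fintype.card ι * charFn ρ S ^ 2 * ℓ * ε ^ 2)⌉₊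

/-- Unfolding of `copies`. [cite: FlammiaLiu2011, eq. (6)] -/
theorem copies_eq (ρ : Matrix (ι → Bool) (ι → Bool) ℂ) (ℓ ε δ : ℝ) (S : ι → Pauli) :
    copies ρ ℓ ε δ S =
      ⌈2 * Real.log (2 / δ) / ((2 : ℝ) ^ Fintype.card ι * charFn ρ S ^ 2 * ℓ * ε ^ 2)⌉₊ := rfl

/-- `d χ_ρ(S)² = Tr(ρ W_S)²` (as `‖Tr(W_S ρ)‖²`) for Hermitian `ρ`. [cite: FlammiaLiu2011, p0002 (χ_ρ(k) = Tr(ρW_k/√d))] -/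
theorem dim_mul_charFn_sq {ρ : Matrix (ι → Bool) (ι → Bool) ℂ} (hρ : ρ.IsHermitian) (S : ι → Pauli) :
    (2 : ℝ) ^ Fintype.card ι * charFn ρ S ^ 2 = ‖pauliCoeff ρ S‖ ^ 2 := by
  rw [norm_pauliCoeff_eq hρ, mul_pow, sq_abs, sqrtDim_sq]

/-- "For well-conditioned states … a much stronger bound that holds with certainty:
`m_i ≤ 1 + 2 log(2/δ)/(α² ℓ ε²)`" (at every setting in the support of the relevance distribution).
[cite: FlammiaLiu2011, p0003 ("m_i ≤ 1 + 2 log(2/δ)/(α²ℓε²)")] -/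
theorem copies_le_of_wellConditioned {ρ : Matrix (ι → Bool) (ι → Bool) ℂ} {α ℓ ε δ : ℝ}
    (hρ : ρ.IsHermitian) (hwc : WellConditioned ρ α) (hα : 0 < α) (hℓ : 0 < ℓ) (hε : 0 < ε)
    (hδ : δ ≤ 2) (hδ' : 0 < δ) {S : ι → Pauli} (hS : charFn ρ S ≠ 0) :
    (copies ρ ℓ ε δ S : ℝ) ≤ 1 + 2 * Real.log (2 / δ) / (α ^ 2 * ℓ * ε ^ 2) := by
  have hlog : 0 ≤ Real.log (2 / δ) := Real.log_nonneg (by rw [le_div_iff₀ hδ']; linarith)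
  have hcoef : α ≤ ‖pauliCoeff ρ S‖ := by
    rcases hwc S with h0 | h
    · exact absurd (by rw [charFn, h0, Complex.zero_re, zero_div]) hS
    · exact h
  have h2log : 0 ≤ 2 * Real.log (2 / δ) := mul_nonneg (by norm_num) hlog
  have hx : 0 ≤ 2 * Real.log (2 / δ) / ((2 : ℝ) ^ Fintype.card ι * charFn ρ S ^ 2 * ℓ * ε ^ 2) :=
    div_nonneg h2log (by positivity)
  have hα2 : α ^ 2 ≤ (2 : ℝ) ^ Fintype.card ι * charFn ρ S ^ 2 := by
    rw [dim_mul_charFn_sq hρ]; exact pow_le_pow_left₀ hα.le hcoef 2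
  have hcb : α ^ 2 * ℓ * ε ^ 2 ≤ (2 : ℝ) ^ Fintype.card ι * charFn ρ S ^ 2 * ℓ * ε ^ 2 :=
    mul_le_mul_of_nonneg_right (mul_le_mul_of_nonneg_right hα2 hℓ.le) (by positivity)
  have hdiv := div_le_div_of_nonneg_left h2log (by positivity : 0 < α ^ 2 * ℓ * ε ^ 2) hcb
  rw [copies_eq]
  calc (⌈2 * Real.log (2 / δ) / ((2 : ℝ) ^ Fintype.card ι * charFn ρ S ^ 2 * ℓ * ε ^ 2)⌉₊ : ℝ)
      ≤ 2 * Real.log (2 / δ) / ((2 : ℝ) ^ Fintype.card ι * charFn ρ S ^ 2 * ℓ * ε ^ 2) + 1 :=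
        (Nat.ceil_lt_add_one hx).le
    _ ≤ 1 + 2 * Real.log (2 / δ) / (α ^ 2 * ℓ * ε ^ 2) := by linarith

/-- There are `4^{|ι|} = d²` Pauli strings. [cite: FlammiaLiu2011, p0002 ("W_k (k = 1, …, d²) denote all possible Pauli operators")] -/
theorem card_pauliStrings : Fintype.card (ι → Pauli) = 4 ^ Fintype.card ι := by
  rw [Fintype.card_fun, Pauli.card_univ]

/-- **Eq. (9)**, expected copies per setting: `𝔼(m_i) = Σ_S χ_ρ(S)² m_S ≤ 1 + 2d log(2/δ)/(ℓ ε²)` for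
a pure target (`Σ_S χ_ρ(S)² = 1`; on the support `χ_ρ(S)² m_S ≤ χ_ρ(S)² + 2 log(2/δ)/(d ℓ ε²)` and the
support has at most `d²` strings). [cite: FlammiaLiu2011, eq. (9) p0003 ("𝔼(m_i) = Σ_{k_i} (χ_ρ(k_i))² m_i ≤ 1 + 2d/(ℓε²) log(2/δ)")] -/
theorem expect_copies_le {ρ : Matrix (ι → Bool) (ι → Bool) ℂ} {ℓ ε δ : ℝ} (hρ : ρ.IsHermitian)
    (hpure : ρ * ρ = ρ) (htr : ρ.trace = 1) (hℓ : 0 < ℓ) (hε : 0 < ε) (hδ : δ ≤ 2) (hδ' : 0 < δ) :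
    ∑ S : ι → Pauli, prob ρ S * (copies ρ ℓ ε δ S : ℝ) ≤
      1 + 2 * (2 : ℝ) ^ Fintype.card ι * Real.log (2 / δ) / (ℓ * ε ^ 2) := by
  set d : ℝ := (2 : ℝ) ^ Fintype.card ι with hd
  have hdpos : 0 < d := by positivity
  have hlog : 0 ≤ Real.log (2 / δ) := Real.log_nonneg (by rw [le_div_iff₀ hδ']; linarith)
  have h2log : 0 ≤ 2 * Real.log (2 / δ) := mul_nonneg (by norm_num) hlog
  set c : ℝ := 2 * Real.log (2 / δ) / (d * ℓ * ε ^ 2) with hc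
  have hcnn : 0 ≤ c := div_nonneg h2log (by positivity)
  -- pointwise bound `Pr(S) m_S ≤ Pr(S) + c`
  have hpt : ∀ S : ι → Pauli, prob ρ S * (copies ρ ℓ ε δ S : ℝ) ≤ prob ρ S + c := by
    intro S
    by_cases h0 : charFn ρ S = 0
    · rw [prob_eq, h0]; simp [hcnn]
    · have hp : 0 < prob ρ S := by rw [prob_eq]; positivity
      have hx : 0 ≤ 2 * Real.log (2 / δ) / (d * charFn ρ S ^ 2 * ℓ * ε ^ 2) :=
        div_nonneg h2log (by positivity)
      have hceil := (Nat.ceil_lt_add_one hx).le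
      rw [copies_eq, ← hd]
      calc prob ρ S * (⌈2 * Real.log (2 / δ) / (d * charFn ρ S ^ 2 * ℓ * ε ^ 2)⌉₊ : ℝ)
          ≤ prob ρ S * (2 * Real.log (2 / δ) / (d * charFn ρ S ^ 2 * ℓ * ε ^ 2) + 1) :=
            mul_le_mul_of_nonneg_left hceil hp.le
        _ = prob ρ S + c := by
            rw [prob_eq, hc]
            field_simp
            ring
  calc ∑ S : ι → Pauli, prob ρ S * (copies ρ ℓ ε δ S : ℝ)
      ≤ ∑ S : ι → Pauli, (prob ρ S + c) := Finset.sum_le_sum fun S _ => hpt S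
    _ = 1 + (4 : ℝ) ^ Fintype.card ι * c := by
        rw [Finset.sum_add_distrib, sum_prob_eq_one hρ hpure htr, Finset.sum_const, Finset.card_univ,
          card_pauliStrings, nsmul_eq_mul]
        push_cast
        ring
    _ = 1 + 2 * d * Real.log (2 / δ) / (ℓ * ε ^ 2) := by
        rw [hc, show (4 : ℝ) ^ Fintype.card ι = d * d by
          rw [hd, ← mul_pow]; norm_num]
        field_simp

/-! ### The stabilizer case of eq. (2): `d` equally weighted strings -/

/-- If `ρ = (1/d) Σ_T c_T W_T` is given by its Pauli expansion with real coefficients `c`, then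
`χ_ρ(T) = c_T/√d` — so for a stabilizer state (`c_T = ±1` on the `d` elements of the stabilizer group,
`0` elsewhere) "χ_ρ(k) takes on values of ±1/√d at the d points in the stabilizer group of ρ, and
vanishes everywhere else", and the relevance distribution is uniform on the stabilizer group (the
sibling file `StabilizerFidelityEstimation.lean` treats that case through the generators).
[cite: FlammiaLiu2011, p0002 ("if ρ is a stabilizer state, χ_ρ(k) takes on values of ±1/√d at the d points in the stabilizer group of ρ, and vanishes everywhere else")] -/
theorem charFn_of_eq_sum_smul (c : (ι → Pauli) → ℝ) {ρ : Matrix (ι → Bool) (ι → Bool) ℂ}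
    (hρ : ρ = ((2 : ℂ) ^ Fintype.card ι)⁻¹ • ∑ T : ι → Pauli, ((c T : ℝ) : ℂ) • pauliString T)
    (T : ι → Pauli) : charFn ρ T = c T / sqrtDim ι := by
  have h2 : ((2 : ℂ) ^ Fintype.card ι) ≠ 0 := pow_ne_zero _ two_ne_zero
  have hcoeff : pauliCoeff ρ T = c T := by
    rw [hρ, pauliCoeff_smul, pauliCoeff_sum]
    simp only [pauliCoeff_smul, pauliCoeff_eq (pauliString _), trace_pauliString_mul_pauliString,
      mul_ite, mul_zero, Finset.sum_ite_eq, Finset.mem_univ, if_true]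
    field_simp
  rw [charFn, hcoeff, Complex.ofReal_re]

/-- In that situation `Pr(T) = c_T²/d`: uniform (`= 1/d`) on the strings with `c_T = ±1` and zero
elsewhere. [cite: FlammiaLiu2011, p0002 (stabilizer states: "So the sum in (1) contains only d terms")] -/
theorem prob_of_eq_sum_smul (c : (ι → Pauli) → ℝ) {ρ : Matrix (ι → Bool) (ι → Bool) ℂ}
    (hρ : ρ = ((2 : ℂ) ^ Fintype.card ι)⁻¹ • ∑ T : ι → Pauli, ((c T : ℝ) : ℂ) • pauliString T)
    (T : ι → Pauli) : prob ρ T = c T ^ 2 / (2 : ℝ) ^ Fintype.card ι := by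
  rw [prob_eq, charFn_of_eq_sum_smul c hρ, div_pow, sqrtDim_sq]

end DFE

end Literature.InformationTheory.QuantumLearning
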